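import Summits.QuantumFields.YangMills.Theorems.ColdStartUniversalityLatticeLangevinSkeletonHoeffding
import HarnessLib

/-!
# Route `ColdStartUniversality` (fixed-cut-off SZZ dynamics, sampler statistics): ★★★ VOLUME-FREE SAMPLE COMPLEXITY FOR ESTIMATING GIBBS
# PROBABILITIES AND MEANS FROM ONE COLD-START RUN — two-sided sharp Hoeffding for `N` samples at any spacing `h`, `|β'| < 1/12`

Helper file (seat `ym-line-csu-p1`, g37; `--supports stmt-QuantumFields-24809`).  SU(2) lattice Langevin dynamics of Shen–Zhu–Zhu at `(L, β')`
with `|β'| < 1/12` (`λ = 1 − 12|β'|`), Wilson measure `μ = μ_{β'}`, burn-in `a = 2 + t₀ + u` with `log B ≤ 2λt₀` (`t₀ = O(log L)`), `N = n+1`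
samples `U_a, U_{a+h}, …, U_{a+nh}` at ANY spacing `h > 0`, `r = e^{−λh}`.  Consequences of the sharp one-sided Hoeffding inequality
`coldStart_skeleton_hoeffding_tail_uniform` (León–Perron variance proxy `(1+r)/(1−r)·b²`):

* ★★★ `coldStart_skeleton_hoeffding_deviation_uniform` — two-sided, every bounded measurable `G` with `|G| ≤ 1`:
  `P[ |N⁻¹Σ_{k<N} G(U_{a+kh}) − μ_{β'}G| ≥ ε ] ≤ 2e² · exp(−N · ((1−r)/(1+r)) · ε²/8)`;
* ★★★ `coldStart_skeleton_frequency_deviation_uniform` — EMPIRICAL FREQUENCIES: for every measurable set `A` of configurations,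
  `P[ |N⁻¹ #{k < N : U_{a+kh} ∈ A} − μ_{β'}(A)| ≥ ε ] ≤ 2e² · exp(−N · ((1−r)/(1+r)) · ε²/2)`
  (`|𝟙_A − μ(A)| ≤ 1`): the fraction of samples in `A` estimates the Gibbs probability of `A` with `N = 2·((1+r)/(1−r))·log(2e²/δ)/ε²`
  samples at confidence `1 − δ`, for EVERY event and EVERY torus size `L` — the price of the volume is only the burn-in `O(log L)`.

[cite: LeonPerron2004, Theorem 1] [cite: DiaconisSaloffcoste1996, Theorem 3.7].  THEOREMS ONLY, no definition, no sorry.  HONEST FRAMING: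
RECORD-rung R3 plumbing at FIXED cut-off in LATTICE units, high-temperature window `|β'| < 1/12` only; the route's scaling `β'_K → ∞` leaves the
window; `UniformColdStartMixing` (24809) is NOT restated; nothing K-uniform is proved; no crux, rung or summit statement is proved; the
Yang–Mills mass gap is NOT proved.
-/

set_option autoImplicit false

noncomputable section

namespace Summit.QuantumFields.YangMills.Theorems.ColdStartUniversality

open MeasureTheory ProbabilityTheory Filter Set
open scoped BigOperators NNReal ENNReal
open Literature.Probability.Process Literature.MathematicalPhysics.QuantumFieldTheory
open Literature.MathematicalPhysics.QuantumLattice (fundamentalRep fundamentalLatticeRep continuous_fundamentalRep)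

variable {L : ℕ} [NeZero L]

/-- ★★★ **TWO-SIDED SHARP HOEFFDING INEQUALITY FOR DISCRETE SAMPLES, `|β'| < 1/12`, volume-free after the burn-in.**  For every `L`,
`|β'| < 1/12` (`λ := 1 − 12|β'|`, `r := e^{−λh}`), every deterministic start `z`, EVERY strong solution `U` from `z` on ANY filtered probability
space, EVERY measurable `G` with `|G| ≤ 1`, all `t₀, u` with `log B ≤ 2λt₀`, every `h > 0`, `n` and `ε > 0`:

  `P[ |(n+1)⁻¹ Σ_{k<n+1} G(U_{2+t₀+u+kh}) − ∫ G dμ_{β'}| ≥ ε ] ≤ 2e² · exp(−(n+1) · ((1−r)/(1+r)) · ε²/8)`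

(`|G − μG| ≤ 2`; the one-sided bound for `G` and `−G`). [cite: LeonPerron2004, Theorem 1] -/
theorem coldStart_skeleton_hoeffding_deviation_uniform (L : ℕ) [NeZero L] (β' : ℝ) (hβ : |β'| < 1 / 12)
    (z : GaugeConfig 3 L (Matrix.specialUnitaryGroup (Fin 2) ℂ))
    {Ω : Type} [MeasurableSpace Ω] {P : Measure Ω} [IsProbabilityMeasure P]
    {W : ℝ≥0 → Ω → (Edge 3 L × NoiseIdx 2 → ℝ)} (hW : IsFlatBrownian W P)
    {U : ℝ≥0 → Ω → GaugeConfig 3 L (Matrix.specialUnitaryGroup (Fin 2) ℂ)} (hU0 : ∀ ω, U 0 ω = z)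
    (hU : (latticeLangevinDynamics (fundamentalLatticeRep 2) β').IsSolution (fundamentalRep (Fin 2)) hW.natFiltration P W U)
    {G : GaugeConfig 3 L (Matrix.specialUnitaryGroup (Fin 2) ℂ) → ℝ} (hG : Measurable G) (hG1 : ∀ x, |G x| ≤ 1) (t₀ u h : ℝ≥0)
    (ht₀ : Real.log (96 * |β'| * (Fintype.card (Edge 3 L) : ℝ) + 10 * |β'| * (Fintype.card (Plaquette 3 L) : ℝ) + Real.log 2 +
      (Fintype.card (Edge 3 L) : ℝ) * Real.log (3 / 2)) ≤ 2 * (1 - 12 * |β'|) * t₀)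
    (hh : 0 < (h : ℝ)) (n : ℕ) {ε : ℝ} (hε : 0 < ε) :
    P.real {ω | ε ≤ |((n : ℝ) + 1)⁻¹ * (∑ k ∈ Finset.range (n + 1), G (U (2 + t₀ + u + (k : ℝ≥0) * h) ω)) - ∫ y, G y ∂(wilsonMeasure (d := 3) (L := L) (fundamentalRep (Fin 2)) β')|} ≤
      2 * Real.exp 2 * Real.exp (-(((n : ℝ) + 1) * ((1 - Real.exp (-((1 - 12 * |β'|) * h))) / (1 + Real.exp (-((1 - 12 * |β'|) * h)))) *
        ε ^ 2 / 8)) := by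
  classical
  haveI : IsProbabilityMeasure (wilsonMeasure (d := 3) (L := L) (fundamentalRep (Fin 2)) β') :=
    isProbabilityMeasure_wilsonMeasure (d := 3) (L := L) (fundamentalRep (Fin 2)) (continuous_fundamentalRep (Fin 2)) β'
  have hm1 : |∫ y, G y ∂(wilsonMeasure (d := 3) (L := L) (fundamentalRep (Fin 2)) β')| ≤ 1 := abs_integral_le_of_abs_le_of_isProbabilityMeasure hG1
  have hGb : ∀ x, |G x - ∫ y, G y ∂(wilsonMeasure (d := 3) (L := L) (fundamentalRep (Fin 2)) β')| ≤ 2 := fun x => (abs_sub _ _).trans (by linarith [hG1 x, hm1])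
  have hplus := coldStart_skeleton_hoeffding_tail_uniform L β' hβ z hW hU0 hU hG (by norm_num) hGb t₀ u h ht₀ hh n hε
  have hnegm : ∫ y, -G y ∂(wilsonMeasure (d := 3) (L := L) (fundamentalRep (Fin 2)) β') = -∫ y, G y ∂(wilsonMeasure (d := 3) (L := L) (fundamentalRep (Fin 2)) β') := integral_neg _
  have hGb' : ∀ x, |(-G x) - ∫ y, -G y ∂(wilsonMeasure (d := 3) (L := L) (fundamentalRep (Fin 2)) β')| ≤ 2 := fun x => by
    rw [hnegm, show -G x - -∫ y, G y ∂(wilsonMeasure (d := 3) (L := L) (fundamentalRep (Fin 2)) β') = -(G x - ∫ y, G y ∂(wilsonMeasure (d := 3) (L := L) (fundamentalRep (Fin 2)) β')) by ring, abs_neg]; exact hGb x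
  have hminus := coldStart_skeleton_hoeffding_tail_uniform L β' hβ z hW hU0 hU (G := fun x => -G x) hG.neg (by norm_num) hGb' t₀ u h ht₀ hh
    n hε
  simp only [integral_neg, Finset.sum_neg_distrib] at hminus
  have hrate : Real.exp 2 * Real.exp (-(((n : ℝ) + 1) * ((1 - Real.exp (-((1 - 12 * |β'|) * h))) / (1 + Real.exp (-((1 - 12 * |β'|) * h)))) *
      ε ^ 2 / (2 * (2 : ℝ) ^ 2))) = Real.exp 2 * Real.exp (-(((n : ℝ) + 1) * ((1 - Real.exp (-((1 - 12 * |β'|) * h))) /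
        (1 + Real.exp (-((1 - 12 * |β'|) * h)))) * ε ^ 2 / 8)) := by norm_num
  rw [hrate] at hplus hminus
  have hsub : {ω | ε ≤ |((n : ℝ) + 1)⁻¹ * (∑ k ∈ Finset.range (n + 1), G (U (2 + t₀ + u + (k : ℝ≥0) * h) ω)) - ∫ y, G y ∂(wilsonMeasure (d := 3) (L := L) (fundamentalRep (Fin 2)) β')|} ⊆
      {ω | ε ≤ ((n : ℝ) + 1)⁻¹ * (∑ k ∈ Finset.range (n + 1), G (U (2 + t₀ + u + (k : ℝ≥0) * h) ω)) - ∫ y, G y ∂(wilsonMeasure (d := 3) (L := L) (fundamentalRep (Fin 2)) β')} ∪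
        {ω | ε ≤ ((n : ℝ) + 1)⁻¹ * (-(∑ k ∈ Finset.range (n + 1), G (U (2 + t₀ + u + (k : ℝ≥0) * h) ω))) - -(∫ y, G y ∂(wilsonMeasure (d := 3) (L := L) (fundamentalRep (Fin 2)) β'))} := by
    intro ω hω
    simp only [Set.mem_setOf_eq, Set.mem_union] at hω ⊢
    rcases le_abs'.1 hω with h1 | h1
    · right
      have : ((n : ℝ) + 1)⁻¹ * (-(∑ k ∈ Finset.range (n + 1), G (U (2 + t₀ + u + (k : ℝ≥0) * h) ω))) =
          -(((n : ℝ) + 1)⁻¹ * ∑ k ∈ Finset.range (n + 1), G (U (2 + t₀ + u + (k : ℝ≥0) * h) ω)) := by ring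
      rw [this]; linarith
    · left; exact h1
  calc P.real {ω | ε ≤ |((n : ℝ) + 1)⁻¹ * (∑ k ∈ Finset.range (n + 1), G (U (2 + t₀ + u + (k : ℝ≥0) * h) ω)) - ∫ y, G y ∂(wilsonMeasure (d := 3) (L := L) (fundamentalRep (Fin 2)) β')|}
      ≤ P.real ({ω | ε ≤ ((n : ℝ) + 1)⁻¹ * (∑ k ∈ Finset.range (n + 1), G (U (2 + t₀ + u + (k : ℝ≥0) * h) ω)) - ∫ y, G y ∂(wilsonMeasure (d := 3) (L := L) (fundamentalRep (Fin 2)) β')} ∪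
          {ω | ε ≤ ((n : ℝ) + 1)⁻¹ * (-(∑ k ∈ Finset.range (n + 1), G (U (2 + t₀ + u + (k : ℝ≥0) * h) ω))) - -(∫ y, G y ∂(wilsonMeasure (d := 3) (L := L) (fundamentalRep (Fin 2)) β'))}) :=
        measureReal_mono hsub
    _ ≤ P.real {ω | ε ≤ ((n : ℝ) + 1)⁻¹ * (∑ k ∈ Finset.range (n + 1), G (U (2 + t₀ + u + (k : ℝ≥0) * h) ω)) - ∫ y, G y ∂(wilsonMeasure (d := 3) (L := L) (fundamentalRep (Fin 2)) β')} +
          P.real {ω | ε ≤ ((n : ℝ) + 1)⁻¹ * (-(∑ k ∈ Finset.range (n + 1), G (U (2 + t₀ + u + (k : ℝ≥0) * h) ω))) - -(∫ y, G y ∂(wilsonMeasure (d := 3) (L := L) (fundamentalRep (Fin 2)) β'))} :=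
        measureReal_union_le _ _
    _ ≤ _ := add_le_add hplus hminus
    _ = _ := by ring

/-- ★★★ **VOLUME-FREE CONCENTRATION OF EMPIRICAL FREQUENCIES AT THE GIBBS PROBABILITIES, `|β'| < 1/12`.**  For every `L`, `|β'| < 1/12`
(`λ := 1 − 12|β'|`, `r := e^{−λh}`), every deterministic start, EVERY strong solution `U`, EVERY measurable set `A` of configurations, all
`t₀, u` with `log B ≤ 2λt₀`, every `h > 0`, `n` and `ε > 0`:

  `P[ |(n+1)⁻¹ Σ_{k<n+1} 𝟙_A(U_{2+t₀+u+kh}) − μ_{β'}(A)| ≥ ε ] ≤ 2e² · exp(−(n+1) · ((1−r)/(1+r)) · ε²/2)`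

— `N = 2·((1+r)/(1−r))·ε⁻²·log(2e²/δ)` samples of ONE cold-start run at spacing `h` after the `O(log L)` burn-in estimate the Gibbs
probability of ANY event to accuracy `ε` with confidence `1 − δ`, uniformly in the torus size `L` (`|𝟙_A − μ(A)| ≤ 1`: the one-sided sharp
Hoeffding bound for `𝟙_A` and `−𝟙_A` with `b = 1`). [cite: LeonPerron2004, Theorem 1] [cite: DiaconisSaloffcoste1996, Theorem 3.7] -/
theorem coldStart_skeleton_frequency_deviation_uniform (L : ℕ) [NeZero L] (β' : ℝ) (hβ : |β'| < 1 / 12)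
    (z : GaugeConfig 3 L (Matrix.specialUnitaryGroup (Fin 2) ℂ))
    {Ω : Type} [MeasurableSpace Ω] {P : Measure Ω} [IsProbabilityMeasure P]
    {W : ℝ≥0 → Ω → (Edge 3 L × NoiseIdx 2 → ℝ)} (hW : IsFlatBrownian W P)
    {U : ℝ≥0 → Ω → GaugeConfig 3 L (Matrix.specialUnitaryGroup (Fin 2) ℂ)} (hU0 : ∀ ω, U 0 ω = z)
    (hU : (latticeLangevinDynamics (fundamentalLatticeRep 2) β').IsSolution (fundamentalRep (Fin 2)) hW.natFiltration P W U)
    {A : Set (GaugeConfig 3 L (Matrix.specialUnitaryGroup (Fin 2) ℂ))} (hA : MeasurableSet A) (t₀ u h : ℝ≥0)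
    (ht₀ : Real.log (96 * |β'| * (Fintype.card (Edge 3 L) : ℝ) + 10 * |β'| * (Fintype.card (Plaquette 3 L) : ℝ) + Real.log 2 +
      (Fintype.card (Edge 3 L) : ℝ) * Real.log (3 / 2)) ≤ 2 * (1 - 12 * |β'|) * t₀)
    (hh : 0 < (h : ℝ)) (n : ℕ) {ε : ℝ} (hε : 0 < ε) :
    P.real {ω | ε ≤ |((n : ℝ) + 1)⁻¹ * (∑ k ∈ Finset.range (n + 1), A.indicator (fun _ => (1 : ℝ)) (U (2 + t₀ + u + (k : ℝ≥0) * h) ω)) -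
        ((wilsonMeasure (d := 3) (L := L) (fundamentalRep (Fin 2)) β')).real A|} ≤
      2 * Real.exp 2 * Real.exp (-(((n : ℝ) + 1) * ((1 - Real.exp (-((1 - 12 * |β'|) * h))) / (1 + Real.exp (-((1 - 12 * |β'|) * h)))) *
        ε ^ 2 / 2)) := by
  classical
  haveI : IsProbabilityMeasure (wilsonMeasure (d := 3) (L := L) (fundamentalRep (Fin 2)) β') :=
    isProbabilityMeasure_wilsonMeasure (d := 3) (L := L) (fundamentalRep (Fin 2)) (continuous_fundamentalRep (Fin 2)) β'
  have hGm : Measurable (A.indicator fun _ => (1 : ℝ)) := measurable_const.indicator hA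
  have hmean : ∫ y, A.indicator (fun _ => (1 : ℝ)) y ∂(wilsonMeasure (d := 3) (L := L) (fundamentalRep (Fin 2)) β') = ((wilsonMeasure (d := 3) (L := L) (fundamentalRep (Fin 2)) β')).real A := by
    rw [integral_indicator hA, setIntegral_const, smul_eq_mul, mul_one]
  have hp0 : 0 ≤ ((wilsonMeasure (d := 3) (L := L) (fundamentalRep (Fin 2)) β')).real A := measureReal_nonneg
  have hp1 : ((wilsonMeasure (d := 3) (L := L) (fundamentalRep (Fin 2)) β')).real A ≤ 1 := measureReal_le_one
  have hGb : ∀ x, |A.indicator (fun _ => (1 : ℝ)) x - ∫ y, A.indicator (fun _ => (1 : ℝ)) y ∂(wilsonMeasure (d := 3) (L := L) (fundamentalRep (Fin 2)) β')| ≤ 1 := fun x => by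
    rw [hmean]
    by_cases hx : x ∈ A
    · simp only [Set.indicator_of_mem hx]; rw [abs_le]; constructor <;> linarith
    · simp only [Set.indicator_of_notMem hx]; rw [abs_le]; constructor <;> linarith
  have hplus := coldStart_skeleton_hoeffding_tail_uniform L β' hβ z hW hU0 hU hGm one_pos hGb t₀ u h ht₀ hh n hε
  have hnegm : ∫ y, -A.indicator (fun _ => (1 : ℝ)) y ∂(wilsonMeasure (d := 3) (L := L) (fundamentalRep (Fin 2)) β') = -((wilsonMeasure (d := 3) (L := L) (fundamentalRep (Fin 2)) β')).real A := by rw [integral_neg, hmean]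
  have hGb' : ∀ x, |(-A.indicator (fun _ => (1 : ℝ)) x) - ∫ y, -A.indicator (fun _ => (1 : ℝ)) y ∂(wilsonMeasure (d := 3) (L := L) (fundamentalRep (Fin 2)) β')| ≤ 1 := fun x => by
    rw [hnegm, show -A.indicator (fun _ => (1 : ℝ)) x - -((wilsonMeasure (d := 3) (L := L) (fundamentalRep (Fin 2)) β')).real A = -(A.indicator (fun _ => (1 : ℝ)) x - ((wilsonMeasure (d := 3) (L := L) (fundamentalRep (Fin 2)) β')).real A) by ring, abs_neg,
      ← hmean]
    exact hGb x
  have hminus := coldStart_skeleton_hoeffding_tail_uniform L β' hβ z hW hU0 hU (G := fun x => -A.indicator (fun _ => (1 : ℝ)) x) hGm.neg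
    one_pos hGb' t₀ u h ht₀ hh n hε
  simp only [integral_neg, Finset.sum_neg_distrib] at hminus
  rw [hmean] at hplus hminus
  have hrate : Real.exp 2 * Real.exp (-(((n : ℝ) + 1) * ((1 - Real.exp (-((1 - 12 * |β'|) * h))) / (1 + Real.exp (-((1 - 12 * |β'|) * h)))) *
      ε ^ 2 / (2 * (1 : ℝ) ^ 2))) = Real.exp 2 * Real.exp (-(((n : ℝ) + 1) * ((1 - Real.exp (-((1 - 12 * |β'|) * h))) /
        (1 + Real.exp (-((1 - 12 * |β'|) * h)))) * ε ^ 2 / 2)) := by norm_num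
  rw [hrate] at hplus hminus
  have hsub : {ω | ε ≤ |((n : ℝ) + 1)⁻¹ * (∑ k ∈ Finset.range (n + 1), A.indicator (fun _ => (1 : ℝ)) (U (2 + t₀ + u + (k : ℝ≥0) * h) ω)) -
        ((wilsonMeasure (d := 3) (L := L) (fundamentalRep (Fin 2)) β')).real A|} ⊆
      {ω | ε ≤ ((n : ℝ) + 1)⁻¹ * (∑ k ∈ Finset.range (n + 1), A.indicator (fun _ => (1 : ℝ)) (U (2 + t₀ + u + (k : ℝ≥0) * h) ω)) -
          ((wilsonMeasure (d := 3) (L := L) (fundamentalRep (Fin 2)) β')).real A} ∪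
        {ω | ε ≤ ((n : ℝ) + 1)⁻¹ * (-(∑ k ∈ Finset.range (n + 1), A.indicator (fun _ => (1 : ℝ)) (U (2 + t₀ + u + (k : ℝ≥0) * h) ω))) -
          -((wilsonMeasure (d := 3) (L := L) (fundamentalRep (Fin 2)) β')).real A} := by
    intro ω hω
    simp only [Set.mem_setOf_eq, Set.mem_union] at hω ⊢
    rcases le_abs'.1 hω with h1 | h1
    · right
      have : ((n : ℝ) + 1)⁻¹ * (-(∑ k ∈ Finset.range (n + 1), A.indicator (fun _ => (1 : ℝ)) (U (2 + t₀ + u + (k : ℝ≥0) * h) ω))) =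
          -(((n : ℝ) + 1)⁻¹ * ∑ k ∈ Finset.range (n + 1), A.indicator (fun _ => (1 : ℝ)) (U (2 + t₀ + u + (k : ℝ≥0) * h) ω)) := by ring
      rw [this]; linarith
    · left; exact h1
  calc P.real {ω | ε ≤ |((n : ℝ) + 1)⁻¹ * (∑ k ∈ Finset.range (n + 1), A.indicator (fun _ => (1 : ℝ)) (U (2 + t₀ + u + (k : ℝ≥0) * h) ω)) -
        ((wilsonMeasure (d := 3) (L := L) (fundamentalRep (Fin 2)) β')).real A|}
      ≤ P.real ({ω | ε ≤ ((n : ℝ) + 1)⁻¹ * (∑ k ∈ Finset.range (n + 1), A.indicator (fun _ => (1 : ℝ)) (U (2 + t₀ + u + (k : ℝ≥0) * h) ω)) -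
            ((wilsonMeasure (d := 3) (L := L) (fundamentalRep (Fin 2)) β')).real A} ∪
          {ω | ε ≤ ((n : ℝ) + 1)⁻¹ * (-(∑ k ∈ Finset.range (n + 1), A.indicator (fun _ => (1 : ℝ)) (U (2 + t₀ + u + (k : ℝ≥0) * h) ω))) -
            -((wilsonMeasure (d := 3) (L := L) (fundamentalRep (Fin 2)) β')).real A}) := measureReal_mono hsub
    _ ≤ P.real {ω | ε ≤ ((n : ℝ) + 1)⁻¹ * (∑ k ∈ Finset.range (n + 1), A.indicator (fun _ => (1 : ℝ)) (U (2 + t₀ + u + (k : ℝ≥0) * h) ω)) -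
            ((wilsonMeasure (d := 3) (L := L) (fundamentalRep (Fin 2)) β')).real A} +
          P.real {ω | ε ≤ ((n : ℝ) + 1)⁻¹ * (-(∑ k ∈ Finset.range (n + 1), A.indicator (fun _ => (1 : ℝ)) (U (2 + t₀ + u + (k : ℝ≥0) * h) ω))) -
            -((wilsonMeasure (d := 3) (L := L) (fundamentalRep (Fin 2)) β')).real A} := measureReal_union_le _ _
    _ ≤ _ := add_le_add hplus hminus
    _ = _ := by ring

end Summit.QuantumFields.YangMills.Theorems.ColdStartUniversality

end
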